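import Literature.NumberTheory.EllipticCurves.TateNormalFormComponentHomProofs
import Literature.NumberTheory.EllipticCurves.SplitMultiplicativeNormalForm
import Summits.BirchSwinnertonDyer.Rank1Residual.JET.E0ReceptacleOfEmbedding
import HarnessLib

/-!
# ErratumRoadFive, crux `EulerHalfNotRamNoInertSetAtFive` (stmt-BirchSwinnertonDyer-19715), ideator line
# `aux_norm_receptacle`, stub S1 `TateComponentFamily` — step F1b: the LOCAL Tate component character on
# `E(K̄_v)` with kernel the receptacle `E⁰(K̄_v) = X11b.E0Receptacle W v`

Cell `bsd-stepL`, width seat `bsd-line-er5-p1-w3` g6. THEOREMS ONLY (no definition, no named fact, no `sorry`);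
`--supports stmt-BirchSwinnertonDyer-19715`. HONEST FRAMING: nothing here closes 19715 (closed modulo items by the
LEAD, p639606) and nothing touches item 27982; this is bottom-up kernel plumbing for the ideator's stub S1
(`Cruxes/EulerHalfNotRamNoInertSetAtFive/Lines/aux_norm_receptacle.lean` v4, `stub_tateComponentFamily`); no
summit statement is proved; BSD is proved for no curve.

## What

For an elliptic curve `W` over a number field `K` with SPLIT MULTIPLICATIVE reduction at the finite place `v`
(`W.HasSplitMultiplicativeReductionAt v`), on the local coefficient module `E(K̄_v) = localPoints W K_v` with its
`Γ_{K_v}`-action (`Sha.lean`):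

* `exists_componentHom_localPoints` — there are a subgroup `Dom ≤ E(K̄_v)` and an additive
  `comp : Dom →+ ZMod (ord_v Δ_min)` (`W.ordMinimalDiscriminant v = c_v`, the Tamagawa number at a split place)
  such that (1) every point fixed by the inertia group `I_𝔐` of any prime `𝔐` of `\bar 𝓞_v` above `𝓂_v` lies in
  `Dom` (all of `E(K_v^nr)`), (2) `E0Receptacle W v ≤ Dom`, (3) for `P ∈ Dom`: `comp P = 0 ↔ P ∈ E0Receptacle W v`,
  (4) `Dom` is `Γ_{K_v}`-stable and `comp (σ • P) = comp P` (VALUES, not classes), (5) `comp = 1` on some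
  `Γ_{K_v}`-fixed point of `Dom`, and `1 ≤ ord_v Δ_min`.

This is Silverman *ATAEC* Cor. IV.9.2 (d) (`E(L)/E₀(L) ≅ ℤ/ord_v(Δ_min)` for `L/K_v` unramified, split
multiplicative reduction) with the Galois invariance of the proof of Matsuno 2009 Lemma 4.1, TRANSPORTED from the
Tate normal form `J : y² + xy = x³ + αϖᶜ` of the minimal model (tree
`exists_variableChange_localMinimalIntegralModel_eq_tateNormalForm`, `c = W.ordMinimalDiscriminant v`) — where it is
the Literature theorem `IsDedekindDomain.HeightOneSpectrum.exists_componentHom_of_tateNormalForm` (this seat,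
p642730) — to `E(K̄_v)` along the `Γ_{K_v}`-equivariant substitution
`E(K̄_v) ≃ (W ⊗ K_v)(K̄_v) ≃ (M ⊗ K_v)(K̄_v) ≃ (J ⊗ K_v)(K̄_v)` (`congrEquiv`, `pointEquivBaseChange` for the CHOSEN
change of variables `C₀` of `E0Receptacle` and for `D`, `D • M = J`), identifying the receptacle with `E₀` of `J` for
the spectral valuation by Silverman *AEC* VII.§2 (`hasNonsingularReduction_variableChange_some_iff` for the
`𝒪_w`-integral `D`, `reducesToNonsingular_iff_hasNonsingularReduction`).

Role in S1: composed with `E(K[n]) → E(K̄) → E(K̄_v)` (`pointsMap ∘ Point.map e`), whose image is inertia-fixed for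
`v ∤ n` (`KolyvaginH44.resGal_smul_algHom_ringClassField_eq_self`), `comp` gives the component characters
`comp n w` of `TateComponentFamily`; (3) is (K1) through JET's `mem_E0Receptacle_some_iff_hasNonsingularReduction_placeIntModel`,
(4) is the local half of (K3).

References (locators only): [cite: SilvermanATAEC1994, Cor. IV.9.2 (d) (PDF p. 340)] [cite: Matsuno2009, Lemma 4.1 (proof)]
[cite: SilvermanAEC2009, VII.1 Prop. 1.3 (b), VII.§2 Prop. 2.1].
-/

set_option linter.dupNamespace false

noncomputable section

open scoped Classical NNReal
open NumberField IsDedekindDomain Field WeierstrassCurve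

universe u

namespace Summit.BirchSwinnertonDyer.BirchSwinnertonDyer.Theorems.TateComponent

open Literature.NumberTheory.EllipticCurves Literature.NumberTheory.GaloisRepresentations
  IsDedekindDomain.HeightOneSpectrum Summit.BirchSwinnertonDyer.Rank1Residual.X11b

variable {K : Type u} [Field K] [NumberField K]

/-- `toX` of a product of changes of variables: first `C'`, then `C` (`(C C') • W = C • (C' • W)`); private
coordinate plumbing. [folklore] -/
private theorem toX_mul {R : Type*} [Field R] (C C' : VariableChange R) (x : R) :
    (C * C').toX x = C.toX (C'.toX x) := by
  simp only [VariableChange.toX_def, VariableChange.mul_def, Units.val_inv_eq_inv_val, Units.val_mul]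
  field_simp
  ring

/-- `toY` of a product of changes of variables; private coordinate plumbing. [folklore] -/
private theorem toY_mul {R : Type*} [Field R] (C C' : VariableChange R) (x y : R) :
    (C * C').toY x y = C.toY (C'.toX x) (C'.toY x y) := by
  simp only [VariableChange.toX_def, VariableChange.toY_def, VariableChange.mul_def, Units.val_inv_eq_inv_val,
    Units.val_mul]
  field_simp
  ring

set_option maxHeartbeats 1600000 in
/-- **The local Tate component character on `E(K̄_v)` with kernel the receptacle `E⁰(K̄_v)`.** For an elliptic
curve `W/K` over a number field with split multiplicative reduction at the finite place `v` there are a subgroup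
`Dom ≤ E(K̄_v) = localPoints W K_v` and an additive `comp : Dom →+ ℤ/c`, `c = ord_v Δ_min(W) ≥ 1`, with:
(1) every point fixed by the inertia group of any prime of `\bar 𝓞_v` above `𝓂_v` lies in `Dom`; (2)
`E0Receptacle W v ≤ Dom`; (3) `comp P = 0 ↔ P ∈ E0Receptacle W v` for `P ∈ Dom`; (4) for `σ ∈ Γ_{K_v}`, `P ∈ Dom`:
`σ • P ∈ Dom` and `comp (σ • P) = comp P`; (5) `comp P₀ = 1` for some `Γ_{K_v}`-fixed `P₀ ∈ Dom`.
(Silverman *ATAEC* IV.9.2 (d) + Matsuno L4.1's Galois invariance, transported from the Tate normal form of the minimal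
model along the chosen changes of variables.) [cite: SilvermanATAEC1994, Cor. IV.9.2 (d) (PDF p. 340)]
[cite: Matsuno2009, Lemma 4.1 (proof)] [cite: SilvermanAEC2009, VII.§2 Prop. 2.1] -/
theorem exists_componentHom_localPoints (W : WeierstrassCurve K) [W.IsElliptic] (v : HeightOneSpectrum (𝓞 K))
    (hs : W.HasSplitMultiplicativeReductionAt v) :
    ∃ (Dom : AddSubgroup (localPoints W (v.adicCompletion K)))
      (comp : Dom →+ ZMod (W.ordMinimalDiscriminant v)),
      (∀ {𝔐 : Ideal v.localAbsIntegers}, 𝔐 ∈ v.localPrimesAbove → ∀ P : localPoints W (v.adicCompletion K),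
          (∀ τ ∈ 𝔐.inertia (absoluteGaloisGroup (v.adicCompletion K)), τ • P = P) → P ∈ Dom) ∧
      (∀ P, P ∈ E0Receptacle W v → P ∈ Dom) ∧
      (∀ P (hP : P ∈ Dom), comp ⟨P, hP⟩ = 0 ↔ P ∈ E0Receptacle W v) ∧
      (∀ (σ : absoluteGaloisGroup (v.adicCompletion K)) (P) (hP : P ∈ Dom),
          ∃ hσP : σ • P ∈ Dom, comp ⟨σ • P, hσP⟩ = comp ⟨P, hP⟩) ∧
      (∃ (P₀ : localPoints W (v.adicCompletion K)) (h₀ : P₀ ∈ Dom),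
          (∀ σ : absoluteGaloisGroup (v.adicCompletion K), σ • P₀ = P₀) ∧ comp ⟨P₀, h₀⟩ = 1) ∧
      1 ≤ W.ordMinimalDiscriminant v := by
  -- the chosen spectral valuation and structure map of the receptacle
  set w := (v.exists_spectralValuation).choose with hwdef
  have hw : ∀ z, (w z : ℝ) = spectralNorm (v.adicCompletion K) (AlgebraicClosure (v.adicCompletion K)) z :=
    (v.exists_spectralValuation).choose_spec
  set ι₀ := (exists_ringHom_adicCompletionIntegers_integer (v.exists_spectralValuation).choose_spec).choose
    with hι₀def
  have hι : ∀ a, ((ι₀ a : w.integer) : AlgebraicClosure (v.adicCompletion K)) =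
      algebraMap (v.adicCompletion K) (AlgebraicClosure (v.adicCompletion K)) (a : v.adicCompletion K) :=
    (exists_ringHom_adicCompletionIntegers_integer (v.exists_spectralValuation).choose_spec).choose_spec
  -- the minimal model `M`, the chosen `C₀ • W_{K_v} = M ⊗ K_v`, and the Tate normal form `J = D • M`
  set M := W.localMinimalIntegralModel v with hMdef
  set C₀ := (W.exists_variableChange_eq_localMinimalIntegralModel v).choose with hC₀def
  have hC₀ : C₀ • W.baseChange (v.adicCompletion K) =
      M.map (algebraMap (v.adicCompletionIntegers K) (v.adicCompletion K)) :=
    (W.exists_variableChange_eq_localMinimalIntegralModel v).choose_spec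
  obtain ⟨ϖ, hϖ⟩ := IsDiscreteValuationRing.exists_irreducible (v.adicCompletionIntegers K)
  obtain ⟨D, α, hc1, hD⟩ := W.exists_variableChange_localMinimalIntegralModel_eq_tateNormalForm v hs hϖ
  set J : WeierstrassCurve (v.adicCompletionIntegers K) :=
    ⟨1, 0, 0, 0, (α : v.adicCompletionIntegers K) * ϖ ^ W.ordMinimalDiscriminant v⟩ with hJdef
  rw [← hMdef] at hD
  -- the component homomorphism of `J` (Literature)
  obtain ⟨Dom₀, comp₀, h1, h2, h3, h4, g, hg, hgσ, hg1⟩ :=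
    exists_componentHom_of_tateNormalForm hw J hϖ rfl rfl rfl rfl α.isUnit hc1 rfl
  -- `D` over `K_v` and over `K̄_v`
  set D' := D.map (algebraMap (v.adicCompletionIntegers K) (v.adicCompletion K)) with hD'def
  have hDK : D' • M.map (algebraMap (v.adicCompletionIntegers K) (v.adicCompletion K)) =
      J.baseChange (v.adicCompletion K) := by
    change _ = J.map (algebraMap (v.adicCompletionIntegers K) (v.adicCompletion K))
    rw [← hD, map_variableChange]
  -- the transport `Ψ : E(K̄_v) ≃ V(K̄_v)`, `V = (J ⊗ K_v) ⊗ K̄_v` (on the bare point type; `localPoints` is a synonym)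
  let Ψ := (Affine.Point.congrEquiv (baseChange_baseChange_adicCompletion W v).symm).trans <|
      (VariableChange.pointEquivBaseChange (W.baseChange (v.adicCompletion K)) C₀
          (AlgebraicClosure (v.adicCompletion K))).trans <|
        (Affine.Point.congrEquiv (congrArg (fun X : WeierstrassCurve (v.adicCompletion K) ↦
            X.baseChange (AlgebraicClosure (v.adicCompletion K))) hC₀)).trans <|
          (VariableChange.pointEquivBaseChange
              (M.map (algebraMap (v.adicCompletionIntegers K) (v.adicCompletion K))) D'
              (AlgebraicClosure (v.adicCompletion K))).trans
            (Affine.Point.congrEquiv (congrArg (fun X : WeierstrassCurve (v.adicCompletion K) ↦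
              X.baseChange (AlgebraicClosure (v.adicCompletion K))) hDK))
  -- the same isomorphism read on the synonym `localPoints W K_v`
  let ΨL : localPoints W (v.adicCompletion K) ≃+
      ((J.baseChange (v.adicCompletion K)).baseChange (AlgebraicClosure (v.adicCompletion K))).toAffine.Point := Ψ
  have hΨL : ∀ Q : localPoints W (v.adicCompletion K), ΨL Q = Ψ Q := fun _ ↦ rfl
  -- `Ψ` is `Γ_{K_v}`-equivariant
  have hΨσ : ∀ (σ : absoluteGaloisGroup (v.adicCompletion K)) (Q : localPoints W (v.adicCompletion K)),
      Ψ (σ • Q) = Affine.Point.map ((absoluteGaloisGroup.toAlgEquiv _ σ :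
          AlgebraicClosure (v.adicCompletion K) ≃ₐ[v.adicCompletion K] AlgebraicClosure (v.adicCompletion K)) :
          AlgebraicClosure (v.adicCompletion K) →ₐ[v.adicCompletion K] AlgebraicClosure (v.adicCompletion K)) (Ψ Q) := by
    intro σ Q
    change Affine.Point.congrEquiv _ (VariableChange.pointEquivBaseChange _ _ _ (Affine.Point.congrEquiv _
      (VariableChange.pointEquivBaseChange _ _ _ (Affine.Point.congrEquiv _ (σ • Q))))) = _
    rw [congrEquiv_smul, VariableChange.pointEquivBaseChange_map_algEquiv,
      Affine.Point.congrEquiv_baseChange_map hC₀, VariableChange.pointEquivBaseChange_map_algEquiv,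
      Affine.Point.congrEquiv_baseChange_map hDK]
    rfl
  -- the receptacle is `E₀` of `J` for the spectral valuation, through `Ψ`
  have hXe : (J.baseChange (v.adicCompletion K)).baseChange (AlgebraicClosure (v.adicCompletion K)) =
      (J.map ι₀).baseChange (AlgebraicClosure (v.adicCompletion K)) :=
    baseChange_map_eq_baseChange_map_choose v J
  have hV : (D.map ι₀) • (M.map ι₀) = J.map ι₀ := by rw [← hD, map_variableChange]
  have hDι : (D.map ι₀).map (algebraMap w.integer (AlgebraicClosure (v.adicCompletion K))) =
      D'.map (algebraMap (v.adicCompletion K) (AlgebraicClosure (v.adicCompletion K))) := by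
    rw [VariableChange.map_map, hD'def, VariableChange.map_map]
    congr 1
    exact RingHom.ext fun a ↦ hι a
  have hE0 : ∀ Q : localPoints W (v.adicCompletion K),
      Q ∈ E0Receptacle W v ↔ ReducesToNonsingular w (IsLocalRing.residue w.integer) (Ψ Q) := by
    intro Q
    rcases Q with _ | ⟨x, y, h⟩
    · change (0 : localPoints W (v.adicCompletion K)) ∈ E0Receptacle W v ↔
        ReducesToNonsingular w (IsLocalRing.residue w.integer) (Ψ 0)
      rw [map_zero]
      exact ⟨fun _ ↦ reducesToNonsingular_zero, fun _ ↦ zero_mem_E0Receptacle W v⟩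
    · rw [mem_E0Receptacle_iff]
      simp only [Ψ, AddEquiv.trans_apply, Affine.Point.congrEquiv_some,
        VariableChange.pointEquivBaseChange_some]
      rw [← Literature.NumberTheory.EllipticCurves.reducesToNonsingular_congrEquiv_iff
        (r := IsLocalRing.residue w.integer) (h := hXe),
        Affine.Point.congrEquiv_some, reducesToNonsingular_iff_hasNonsingularReduction (J.map ι₀)]
      refine (hasNonsingularReduction_variableChange_some_iff (M.map ι₀) (D.map ι₀) hV ?_ ?_ _ _).symm
      · rw [hDι]
      · rw [hDι]
  -- the transported domain and homomorphism
  let Dom : AddSubgroup (localPoints W (v.adicCompletion K)) := Dom₀.comap ΨL.toAddMonoidHom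
  have hDom : ∀ P, P ∈ Dom ↔ Ψ P ∈ Dom₀ := fun P ↦ Iff.rfl
  let ψD : Dom →+ Dom₀ := (ΨL.toAddMonoidHom.comp Dom.subtype).codRestrict Dom₀ fun P ↦ P.2
  let comp : Dom →+ ZMod (W.ordMinimalDiscriminant v) := comp₀.comp ψD
  have hcomp : ∀ P (hP : P ∈ Dom), comp ⟨P, hP⟩ = comp₀ ⟨Ψ P, hP⟩ := fun _ _ ↦ rfl
  refine ⟨Dom, comp, ?_, ?_, ?_, ?_, ?_, hc1⟩
  · -- (1) inertia-fixed points
    intro 𝔐 h𝔐 P hP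
    rw [hDom]
    refine h1 h𝔐 (Ψ P) fun τ hτ ↦ ?_
    rw [← hΨσ, hP τ hτ]
  · -- (2) the receptacle lies in `Dom`
    intro P hP
    rw [hDom]
    exact h2 (Ψ P) ((hE0 P).mp hP)
  · -- (3) kernel = receptacle
    intro P hP
    rw [hcomp, h3, hE0]
  · -- (4) Galois invariance
    intro σ P hP
    obtain ⟨hσ₀, hval⟩ := h4 σ (Ψ P) hP
    have hσP : σ • P ∈ Dom := by rw [hDom, hΨσ]; exact hσ₀
    refine ⟨hσP, ?_⟩
    rw [hcomp, hcomp]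
    have e : (⟨Ψ (σ • P), hσP⟩ : Dom₀) = ⟨_, hσ₀⟩ := Subtype.ext (hΨσ σ P)
    rw [e, hval]
  · -- (5) a rational point with `comp = 1`
    have hgg : Ψ (ΨL.symm g) = g := AddEquiv.apply_symm_apply ΨL g
    have hP₀ : ΨL.symm g ∈ Dom := by rw [hDom, hgg]; exact hg
    refine ⟨ΨL.symm g, hP₀, fun σ ↦ ?_, ?_⟩
    · apply ΨL.injective
      rw [hΨL, hΨL, hΨσ, hgg, hgσ σ]
    · rw [hcomp]
      have e : (⟨Ψ (ΨL.symm g), hP₀⟩ : Dom₀) = ⟨g, hg⟩ := Subtype.ext hgg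
      rw [e, hg1]

end Summit.BirchSwinnertonDyer.BirchSwinnertonDyer.Theorems.TateComponent

end
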